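import Summits.MatrixMultiplication.OmegaCensus.STPPZoo313CheckerSound

/-!
# ω-census (abelian STPP census): soundness pieces for the zoo checker — DIFFERENCE SEQUENCES of strictly increasing lists (kernel tool)

HONEST FRAMING (pub-omega census; verbatim): lottery ticket; floor = certified bounds/negative ranges.
Census STRUCTURE (seat pub-omega-stpp-1 gen 33, 2026-08-29), family (b2).  Fourth soundness piece for the zoo checker (`STPPZoo313Checker.lean`):
`diffs` / `elemsFrom` (consecutive differences and their inverse), `elemsFrom_diffs` (a strictly increasing list is recovered from its head and its
differences), `diffs_pos`, `sum_diffs_le`, `length_diffs`; `zooValid_of` (entries `≥ 1`, sum `≤ S`, at most `bb` entries `≥ 2` ⇒ `ZooValid S bb`);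
the generator state along `ds` (`zooRun_els`, `tb_zooRun_mask`, `zooRun_bb`); and the RUN-END count `length_filter_succ_not_mem` (for `a :: elemsFrom ds a`
with all `d ≥ 1`, the elements `v` with `v + 1` not in the list number `1 + #{d ∈ ds : 2 ≤ d}`).  No `decide`.  Nothing here is progress on `ω`.

References: H. Cohn, R. Kleinberg, B. Szegedy, C. Umans, FOCS 2005 (arXiv:math/0511460), Def. 5.1.
-/

namespace Summit.MatrixMultiplication.OmegaCensus.CubeNB.S2

open Summit.MatrixMultiplication.OmegaCensus.CubeNB.Bits

/-! ## §1 Differences and elements -/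

/-- Consecutive differences of a list of naturals. [folklore] -/
def diffs : List ℕ → List ℕ
  | a :: b :: t => (b - a) :: diffs (b :: t)
  | _ => []

/-- The elements generated from a start `a` by successive differences (the start itself excluded). [folklore] -/
def elemsFrom : List ℕ → ℕ → List ℕ
  | [], _ => []
  | d :: ds, a => (a + d) :: elemsFrom ds (a + d)

/-- `diffs` of a non-empty list has one entry less. [folklore] -/
theorem length_diffs : ∀ (a : ℕ) (t : List ℕ), (diffs (a :: t)).length = t.length
  | _, [] => rfl
  | _, b :: t => by rw [diffs, List.length_cons, List.length_cons, length_diffs b t]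

/-- `elemsFrom` has as many elements as differences. [folklore] -/
theorem length_elemsFrom : ∀ (ds : List ℕ) (a : ℕ), (elemsFrom ds a).length = ds.length
  | [], _ => rfl
  | d :: ds, a => by rw [elemsFrom, List.length_cons, List.length_cons, length_elemsFrom ds (a + d)]

/-- **A strictly increasing list is recovered from its head and its differences.** [folklore] -/
theorem elemsFrom_diffs : ∀ (a : ℕ) (t : List ℕ), (a :: t).Pairwise (· < ·) → elemsFrom (diffs (a :: t)) a = t
  | a, [], _ => rfl
  | a, b :: t, h => by
    rw [List.pairwise_cons] at h
    have hab : a < b := h.1 b (by simp)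
    rw [diffs, elemsFrom, show a + (b - a) = b by omega, elemsFrom_diffs b t h.2]

/-- The differences of a strictly increasing list are `≥ 1`. [folklore] -/
theorem diffs_pos : ∀ (a : ℕ) (t : List ℕ), (a :: t).Pairwise (· < ·) → ∀ d ∈ diffs (a :: t), 1 ≤ d
  | _, [], _, d, hd => by simp [diffs] at hd
  | a, b :: t, h, d, hd => by
    rw [List.pairwise_cons] at h
    have hab : a < b := h.1 b (by simp)
    rw [diffs, List.mem_cons] at hd
    rcases hd with rfl | hd
    · omega
    · exact diffs_pos b t h.2 d hd

/-- `a + Σ diffs ≤ M` when every element is `≤ M`. [folklore] -/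
theorem sum_diffs_le : ∀ (a : ℕ) (t : List ℕ) (M : ℕ), (a :: t).Pairwise (· < ·) → (∀ v ∈ a :: t, v ≤ M) → a + (diffs (a :: t)).sum ≤ M
  | a, [], M, _, hM => by simpa [diffs] using hM a (by simp)
  | a, b :: t, M, h, hM => by
    rw [List.pairwise_cons] at h
    have hab : a < b := h.1 b (by simp)
    rw [diffs, List.sum_cons, ← Nat.add_assoc, show a + (b - a) = b by omega]
    exact sum_diffs_le b t M h.2 fun v hv => hM v (by simp [hv])

/-- Elements generated by positive differences exceed the start. [folklore] -/
theorem lt_of_mem_elemsFrom : ∀ (ds : List ℕ) (a : ℕ), (∀ d ∈ ds, 1 ≤ d) → ∀ v ∈ elemsFrom ds a, a < v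
  | [], _, _, v, hv => by simp [elemsFrom] at hv
  | d :: ds, a, h1, v, hv => by
    have hd : 1 ≤ d := h1 d (by simp)
    rw [elemsFrom, List.mem_cons] at hv
    rcases hv with rfl | hv
    · omega
    · have := lt_of_mem_elemsFrom ds (a + d) (fun d' hd' => h1 d' (by simp [hd'])) v hv; omega

/-- A list of positive naturals has length at most its sum. [folklore] -/
theorem length_le_sum_of_pos : ∀ (ds : List ℕ), (∀ d ∈ ds, 1 ≤ d) → ds.length ≤ ds.sum
  | [], _ => by simp
  | d :: ds, h1 => by
    rw [List.length_cons, List.sum_cons]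
    have hd : 1 ≤ d := h1 d (by simp)
    have := length_le_sum_of_pos ds fun d' hd' => h1 d' (by simp [hd'])
    omega

/-! ## §2 Validity of a difference sequence for the generator -/

/-- **A budget-respecting difference sequence is `ZooValid`.** [folklore] -/
theorem zooValid_of : ∀ (ds : List ℕ) (S bb : ℕ), (∀ d ∈ ds, 1 ≤ d) → ds.sum ≤ S →
    (ds.filter fun d => decide (2 ≤ d)).length ≤ bb → ZooValid S bb ds
  | [], _, _, _, _, _ => trivial
  | d :: ds, S, bb, h1, hsum, hbig => by
    have hd : 1 ≤ d := h1 d (by simp)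
    have hrest : ∀ d' ∈ ds, 1 ≤ d' := fun d' hd' => h1 d' (by simp [hd'])
    rw [List.sum_cons] at hsum
    have hlen : ds.length ≤ ds.sum := length_le_sum_of_pos ds hrest
    by_cases h2 : 2 ≤ d
    · rw [List.filter_cons_of_pos (by exact decide_eq_true h2), List.length_cons] at hbig
      refine ⟨hd, by omega, fun _ => by omega, ?_⟩
      rw [if_pos h2]
      exact zooValid_of ds (S - d) (bb - 1) hrest (by omega) (by omega)
    · rw [List.filter_cons_of_neg (by simpa using h2)] at hbig
      refine ⟨hd, by omega, fun h => absurd h h2, ?_⟩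
      rw [if_neg h2]
      exact zooValid_of ds (S - d) bb hrest (by omega) hbig

/-! ## §3 The generator state along a difference sequence -/

/-- The element list of `zooRun`: the new elements, reversed, in front of the old ones. [folklore] -/
theorem zooRun_els : ∀ (ds : List ℕ) (bb a m : ℕ) (els : List ℕ),
    (zooRun ds (bb, a, m, els)).2.2.2 = (elemsFrom ds a).reverse ++ els
  | [], bb, a, m, els => by simp [zooRun, elemsFrom]
  | d :: ds, bb, a, m, els => by
    rw [zooRun, zooRun_els ds, elemsFrom, List.reverse_cons, List.append_assoc]; rfl

/-- The last element of `zooRun`. [folklore] -/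
theorem zooRun_pos : ∀ (ds : List ℕ) (bb a m : ℕ) (els : List ℕ), (zooRun ds (bb, a, m, els)).2.1 = a + ds.sum
  | [], bb, a, m, els => by simp [zooRun]
  | d :: ds, bb, a, m, els => by rw [zooRun, zooRun_pos ds, List.sum_cons, Nat.add_assoc]

/-- Bit `k` of `1` is set iff `k = 0`. [folklore] -/
theorem testBit_one_iff (k : ℕ) : Nat.testBit 1 k = true ↔ k = 0 := by
  cases k with
  | zero => simp
  | succ k => simp [Nat.testBit_succ]

/-- The mask of `zooRun`: the old bits and the bits of the new elements. [folklore] -/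
theorem tb_zooRun_mask : ∀ (ds : List ℕ) (bb a m : ℕ) (els : List ℕ) (v : ℕ),
    tb (zooRun ds (bb, a, m, els)).2.2.1 v = true ↔ (tb m v = true ∨ v ∈ elemsFrom ds a)
  | [], bb, a, m, els, v => by simp [zooRun, elemsFrom]
  | d :: ds, bb, a, m, els, v => by
    rw [zooRun, tb_zooRun_mask ds, elemsFrom, List.mem_cons, tb_lor, Bool.or_eq_true, tb_eq_testBit (1 <<< (a + d)),
      Nat.testBit_shiftLeft, Bool.and_eq_true, decide_eq_true_eq, testBit_one_iff]
    constructor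
    · rintro ((h | ⟨h1, h2⟩) | h)
      · exact Or.inl h
      · exact Or.inr (Or.inl (by omega))
      · exact Or.inr (Or.inr h)
    · rintro (h | h | h)
      · exact Or.inl (Or.inl h)
      · exact Or.inl (Or.inr ⟨by omega, by omega⟩)
      · exact Or.inr h

/-- The big-entry budget of `zooRun`: `bb − #{d ∈ ds : 2 ≤ d}` when that many are available. [folklore] -/
theorem zooRun_bb : ∀ (ds : List ℕ) (bb a m : ℕ) (els : List ℕ), (ds.filter fun d => decide (2 ≤ d)).length ≤ bb →
    (zooRun ds (bb, a, m, els)).1 = bb - (ds.filter fun d => decide (2 ≤ d)).length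
  | [], bb, a, m, els, _ => by simp [zooRun]
  | d :: ds, bb, a, m, els, h => by
    rw [zooRun]
    by_cases h2 : 2 ≤ d
    · rw [List.filter_cons_of_pos (by exact decide_eq_true h2), List.length_cons] at h ⊢
      rw [if_pos h2, zooRun_bb ds (bb - 1) _ _ _ (by omega)]; omega
    · rw [List.filter_cons_of_neg (by simpa using h2)] at h ⊢
      rw [if_neg h2, zooRun_bb ds bb _ _ _ h]

/-! ## §4 Run ends -/

/-- **Run ends.**  For the list `a :: elemsFrom ds a` with all `d ≥ 1`, the elements `v` whose successor `v + 1` is not in the list number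
`1 + #{d ∈ ds : 2 ≤ d}`. [folklore] -/
theorem length_filter_succ_not_mem : ∀ (ds : List ℕ) (a : ℕ), (∀ d ∈ ds, 1 ≤ d) →
    ((a :: elemsFrom ds a).filter fun v => !((a :: elemsFrom ds a).elem (v + 1))).length = 1 + (ds.filter fun d => decide (2 ≤ d)).length
  | [], a, _ => by simp [elemsFrom]
  | d :: ds, a, h1 => by
    have hd : 1 ≤ d := h1 d (by simp)
    have hrest : ∀ d' ∈ ds, 1 ≤ d' := fun d' hd' => h1 d' (by simp [hd'])
    have ih := length_filter_succ_not_mem ds (a + d) hrest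
    have hgt : ∀ v ∈ elemsFrom ds (a + d), a + d < v := lt_of_mem_elemsFrom ds (a + d) hrest
    rw [elemsFrom]
    -- membership of `w + 1` in the full list versus the tail, for `w ≥ a + d`
    have hshift : ∀ w, a + d ≤ w →
        ((a :: (a + d) :: elemsFrom ds (a + d)).elem (w + 1)) = (((a + d) :: elemsFrom ds (a + d)).elem (w + 1)) := by
      intro w hw
      rw [Bool.eq_iff_iff, List.elem_iff, List.elem_iff, List.mem_cons]
      constructor
      · rintro (h | h)
        · omega
        · exact h
      · exact fun h => Or.inr h
    -- the head: `a + 1` is in the list iff `d = 1`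
    have hhead : (!((a :: (a + d) :: elemsFrom ds (a + d)).elem (a + 1))) = decide (2 ≤ d) := by
      have hmem : (a + 1 ∈ a :: (a + d) :: elemsFrom ds (a + d)) ↔ d = 1 := by
        rw [List.mem_cons, List.mem_cons]
        constructor
        · rintro (h | h | h)
          · omega
          · omega
          · have := hgt _ h; omega
        · intro h1'; right; left; omega
      by_cases h2 : 2 ≤ d
      · rw [decide_eq_true h2]
        have : (a :: (a + d) :: elemsFrom ds (a + d)).elem (a + 1) = false := by
          rw [Bool.eq_false_iff, ne_eq, List.elem_iff, hmem]; omega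
        rw [this]; rfl
      · rw [decide_eq_false h2]
        have : (a :: (a + d) :: elemsFrom ds (a + d)).elem (a + 1) = true := List.elem_eq_true_of_mem (hmem.2 (by omega))
        rw [this]; rfl
    have htail : (((a + d) :: elemsFrom ds (a + d)).filter fun v => !((a :: (a + d) :: elemsFrom ds (a + d)).elem (v + 1))) =
        (((a + d) :: elemsFrom ds (a + d)).filter fun v => !(((a + d) :: elemsFrom ds (a + d)).elem (v + 1))) := by
      refine List.filter_congr fun v hv => ?_
      have hv' : a + d ≤ v := by
        rw [List.mem_cons] at hv
        rcases hv with rfl | hv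
        · exact le_rfl
        · exact le_of_lt (hgt v hv)
      rw [hshift v hv']
    rw [List.filter_cons, hhead, htail]
    by_cases h2 : 2 ≤ d
    · rw [decide_eq_true h2, if_pos rfl, List.length_cons, ih, List.filter_cons_of_pos (by exact decide_eq_true h2), List.length_cons]
      omega
    · rw [decide_eq_false h2, if_neg (by simp), ih, List.filter_cons_of_neg (by simpa using h2)]

end Summit.MatrixMultiplication.OmegaCensus.CubeNB.S2
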